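import Summits.QuantumFields.YangMills.Theorems.IR.AfPincerUcXPoly

/-!
# `AfPincerUc.AFToOnsetUKPc` (`stub_afOnsetUc`, X^{Uc}) is false in the K-SM∞ world — the typed kill-world
# of the super-polynomial regime (refuter lane B on `stmt-QuantumFields-19354`; Negative lane, helper only)

`stub_afOnsetUc : AFToOnsetUKPc` (skeleton `af_pincer_Uc`, slot d9d9d710e4ae01bd) says: `Q2` is `≤ η` along a
subsequence of tori at every unit `s` with `s · b⋆^{Uc}(β) ≥ T(η)`, where `b⋆^{Uc} = mixOnsetUc` is the least mesh at
which the mixing format `TypShellCondUKPc` holds.  Lane A (`AfPincerUcX`, `AfPincerUcXPoly`) proved X^{Uc} in the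
bounded and polynomial onset regimes and boxed the rest: `afToOnsetUKPc_iff_superpoly_regime` — the open content
sits exactly where `b⋆^{Uc}(β)⁴ (1 + log β)` outgrows every `C₀ β`, and under `LowerBounds G r a` X^{Uc} forces the
ONSET-IN-UNITS pinning `a β · b⋆^{Uc}(β) < T` (`onsetInUnits_of_afToOnsetUKPc`).

This file types the one world in which that pinning fails although nothing else in the line does — the owner's
**K-SM∞** («strong mixing only far above the interaction scale»): an admissible, simply connected `G`, a faithful
unitary `r`, a positive unit map `a` that is NON-TRIVIALITY-CALIBRATED (`LowerBounds G r a`), admissible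
`(n, ε, δ)`, such that the format holds at SOME mesh for the large `β` in question (the world is not a wire world:
`mixOnsetUc ≠ 0`) but FAILS at every mesh `b` with `a β · b ≤ T`, for every `T`, frequently as `β → ∞`
(`LateOnsetAt`).  Results (all sorry-free, real proofs):

* `LateOnsetAt.lt_unit_mul_mixOnsetUc`, `lateOnsetAt_of_unbounded_onsetInUnits`,
  `lateOnsetAt_iff_unbounded_onsetInUnits` — once the format holds at some mesh for all large `β`, a late onset is
  EXACTLY «`a β · b⋆^{Uc}(β)` unbounded along `β → ∞`», i.e. the negation of lane A's X′;
* `not_afToOnsetUKPc_of_lateOnsetAt` — one NT-calibrated late onset at one admissible `(G, r, n, ε, δ)` refutes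
  `AFToOnsetUKPc` (via `onsetInUnits_of_afToOnsetUKPc`, i.e. the generic pincer `fmtOnset_pinned`);
* `KSMInf` (a closed `Prop`, never asserted) and `not_afToOnsetUKPc_of_ksmInf : KSMInf → ¬ AFToOnsetUKPc`.

DECISION RECORDED WITH THIS FILE (refuter memo `KSM-VERDICT.md`, evidence on the item): `KSMInf` is NOT
instantiated and is judged EMPTY at physics grade for simply connected `G` — every mechanism that could drive the
uniform-in-boundary-data (strong-mixing) onset parametrically above the non-triviality scale `1/a(β)` either is a
function of `b · a(β)` alone (single-scale universality: the influence of exterior data on gauge-invariant cell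
events is carried by closed loops, couples quadratically to boundary-induced backgrounds, and is screened at a
boundary mass that is a FIXED multiple of the bulk gap — lattice datum: glueton mass `1.0(1)√σ` against
`M₀₊₊ = 3.405(21)√σ`, Chernodub–Goy–Molochkov–Tanashkin 2023), or is an area-law channel dead beyond the string scale
(central layer twists, charged column·staple lines — the fixed-mesh mechanism of `Negative/TypShellCondFalseFixedMesh`),
or needs a boundary phase transition (the only known route from weak to failed strong mixing: Czech models,
Shlosman 1986; Martinelli, Saint-Flour LNM 1717 §2.3), for which pure Yang–Mills at `β → ∞` offers no degenerate
boundary phase (unique classical vacuum of a faithful Wilson action; metastable plaquette states cost `O(β)` each).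
Wire worlds (forced defects; non-simply-connected `G`) give `mixOnsetUc = 0` and make X^{Uc} vacuously TRUE, not
false (`AfPincerUcX.afToOnsetUKPc_clause_of_onset_eq_zero`-type lemmas of lane A), so they do not populate `KSMInf`
either.  Kernel status: `KSMInf` is neither refutable nor provable from the tree (a refutation is a strong-mixing
statement at scale `O(1/a)`, i.e. the line's I-stub in NT units; a proof needs a non-triviality floor at units
`→ 0`).  Hence this is a HOOK, filed `--supports` (no `--negative-modulo`: the item is not to be held on an `H`
the filer judges empty).

HONEST FRAMING: a typed kill-world and three bookkeeping lemmas about ONE open stub of a CONDITIONAL reduction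
chain (Track A 0/28 UV); `KSMInf`, `AFToOnsetUKPc`, `LowerBounds` are hypotheses / closed Props here and nothing is
asserted about 4-d Yang–Mills; no weak-coupling mixing, no mass gap, not Clay.
-/

set_option autoImplicit false

noncomputable section

open Filter Topology MeasureTheory
open scoped SchwartzMap
open Literature.MathematicalPhysics.QuantumFieldTheory Literature.MathematicalPhysics.QuantumLattice
open Summit.QuantumFields.YangMills.Cruxes.OSLegsFromFemtoAndGap.DlrCollarTransfer (LowerBounds Q2)

namespace Summit.QuantumFields.YangMills.Cruxes.IR.AfPincerUc

/-! ## §1 Late onset at fixed data, and its equivalence with «onset in units unbounded» -/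
section LateOnset

variable {G : Type} [Group G] [TopologicalSpace G] [IsTopologicalGroup G] [CompactSpace G]
  [MeasurableSpace G] [BorelSpace G]

/-- **Late onset of the format `TypShellCondUKPc` at `(G, r, a, n, ε, δ)`** (the `(G, r, n, ε, δ)`-instance of the
K-SM∞ world, `a` the unit map): for every `T` and every threshold `β₁` there is a coupling `β ≥ β₁` at which the
format holds at SOME mesh (so `mixOnsetUc r.ρ β n ε δ ≥ 1` is a genuine onset, not the wire value `0`) but FAILS at
every mesh `b ≥ 1` with `a β · b ≤ T` — the uniform-in-boundary-data mixing scale lies above `T / a β`. -/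
def LateOnsetAt (r : LatticeRep G) (a : ℝ → ℝ) (n : ℕ) (ε δ : ℝ) : Prop :=
  ∀ T β₁ : ℝ, ∃ β : ℝ, β₁ ≤ β ∧ (∃ b : ℕ, 1 ≤ b ∧ TypShellCondUKPc r.ρ β b n ε δ) ∧
    ∀ b : ℕ, 1 ≤ b → a β * (b : ℝ) ≤ T → ¬ TypShellCondUKPc r.ρ β b n ε δ

/-- A late onset makes `a β · b⋆^{Uc}(β)` exceed every `T` beyond every threshold. -/
theorem LateOnsetAt.lt_unit_mul_mixOnsetUc {r : LatticeRep G} {a : ℝ → ℝ} {n : ℕ} {ε δ : ℝ}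
    (h : LateOnsetAt r a n ε δ) (T β₁ : ℝ) :
    ∃ β : ℝ, β₁ ≤ β ∧ T < a β * (mixOnsetUc r.ρ β n ε δ : ℝ) := by
  obtain ⟨β, hβ, ⟨b, hb, hfmt⟩, hfail⟩ := h T β₁
  refine ⟨β, hβ, ?_⟩
  have hne : (fmtSet (fun β' b' => TypShellCondUKPc r.ρ β' b' n ε δ) β).Nonempty := ⟨b, hb, hfmt⟩
  obtain ⟨h1, hP⟩ := fmtOnset_spec (fun β' b' => TypShellCondUKPc r.ρ β' b' n ε δ) β hne
  by_contra hle
  rw [not_lt] at hle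
  exact hfail _ h1 hle hP

/-- Conversely: if the format holds at some mesh for all `β ≥ β₂` and `a β · b⋆^{Uc}(β)` is unbounded beyond every
threshold, the onset is late (`b⋆ ≤ b` for every mesh `b` at which the format holds). -/
theorem lateOnsetAt_of_unbounded_onsetInUnits {r : LatticeRep G} {a : ℝ → ℝ} (ha : ∀ β, 0 < a β) {n : ℕ}
    {ε δ : ℝ} {β₂ : ℝ} (hon : ∀ β : ℝ, β₂ ≤ β → ∃ b : ℕ, 1 ≤ b ∧ TypShellCondUKPc r.ρ β b n ε δ)
    (hunb : ∀ T β₁ : ℝ, ∃ β : ℝ, β₁ ≤ β ∧ T < a β * (mixOnsetUc r.ρ β n ε δ : ℝ)) :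
    LateOnsetAt r a n ε δ := by
  intro T β₁
  obtain ⟨β, hβ, hT⟩ := hunb T (max β₁ β₂)
  refine ⟨β, le_trans (le_max_left _ _) hβ, hon β (le_trans (le_max_right _ _) hβ), fun b hb hle hfmt => ?_⟩
  have hmin : mixOnsetUc r.ρ β n ε δ ≤ b :=
    fmtOnset_le (fun β' b' => TypShellCondUKPc r.ρ β' b' n ε δ) β hb hfmt
  have hcast : (mixOnsetUc r.ρ β n ε δ : ℝ) ≤ (b : ℝ) := by exact_mod_cast hmin
  have hmul : a β * (mixOnsetUc r.ρ β n ε δ : ℝ) ≤ a β * (b : ℝ) := mul_le_mul_of_nonneg_left hcast (ha β).le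
  linarith

/-- **Late onset ⟺ onset in units unbounded** (given that the format holds at some mesh for all large `β`, i.e. the
conclusion of the I-stub at these `(n, ε, δ)`): K-SM∞ at fixed data is literally the failure of lane A's X′. -/
theorem lateOnsetAt_iff_unbounded_onsetInUnits {r : LatticeRep G} {a : ℝ → ℝ} (ha : ∀ β, 0 < a β) {n : ℕ}
    {ε δ : ℝ} {β₂ : ℝ} (hon : ∀ β : ℝ, β₂ ≤ β → ∃ b : ℕ, 1 ≤ b ∧ TypShellCondUKPc r.ρ β b n ε δ) :
    LateOnsetAt r a n ε δ ↔ ∀ T β₁ : ℝ, ∃ β : ℝ, β₁ ≤ β ∧ T < a β * (mixOnsetUc r.ρ β n ε δ : ℝ) :=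
  ⟨fun h T β₁ => h.lt_unit_mul_mixOnsetUc T β₁, lateOnsetAt_of_unbounded_onsetInUnits ha hon⟩

/-- The negation, spelled out: NO late onset ⟺ lane A's X′ («`a β · b⋆^{Uc}(β) ≤ T` for all large `β`, some `T`»),
given that the format holds at some mesh for all large `β`. -/
theorem not_lateOnsetAt_iff_onsetInUnits {r : LatticeRep G} {a : ℝ → ℝ} (ha : ∀ β, 0 < a β) {n : ℕ}
    {ε δ : ℝ} {β₂ : ℝ} (hon : ∀ β : ℝ, β₂ ≤ β → ∃ b : ℕ, 1 ≤ b ∧ TypShellCondUKPc r.ρ β b n ε δ) :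
    ¬ LateOnsetAt r a n ε δ ↔ ∃ T β₁ : ℝ, ∀ β : ℝ, β₁ ≤ β → a β * (mixOnsetUc r.ρ β n ε δ : ℝ) ≤ T := by
  rw [lateOnsetAt_iff_unbounded_onsetInUnits ha hon]
  push Not
  rfl

end LateOnset

/-! ## §2 The kill: a late onset in an NT-calibrated world refutes `AFToOnsetUKPc` -/
section Kill

variable {G : Type} [Group G] [TopologicalSpace G] [IsTopologicalGroup G] [CompactSpace G]

/-- **`stub_afOnsetUc` is false at a late onset.**  If `G` is admissible, `a` is a positive unit map carrying the
route's non-triviality floor `LowerBounds G r a`, `(n, ε, δ)` is admissible and the onset is late at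
`(G, r, a, n, ε, δ)`, then `AFToOnsetUKPc` fails — its `(G, r, n, ε, δ)`-clause would pin `a β · b⋆^{Uc}(β) < T`
(`onsetInUnits_of_afToOnsetUKPc`), which a late onset denies.  Hypotheses form; nothing asserted. -/
theorem not_afToOnsetUKPc_of_lateOnsetAt (hG : IsCompactSimpleLieGroup G) :
    letI : MeasurableSpace G := borel G; haveI : BorelSpace G := ⟨rfl⟩;
    ∀ (r : LatticeRep G) (a : ℝ → ℝ), (∀ β, 0 < a β) → LowerBounds G r a →
      ∀ (n : ℕ) (ε δ : ℝ), 1 ≤ n → 0 ≤ ε → ε * OnsetFormats.shellCount n ≤ 3 / 4 → 0 < δ →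
        LateOnsetAt r a n ε δ → ¬ AFToOnsetUKPc := by
  letI : MeasurableSpace G := borel G
  haveI : BorelSpace G := ⟨rfl⟩
  intro r a ha hlb n ε δ hn hε hM hδ hlate hX
  obtain ⟨T, β₆, hpin⟩ := onsetInUnits_of_afToOnsetUKPc hX G hG r a ha hlb n ε hn hε hM δ hδ
  obtain ⟨β, hβ, hT⟩ := hlate.lt_unit_mul_mixOnsetUc T β₆
  exact absurd (hpin β hβ) (not_lt.mpr hT.le)

end Kill

/-! ## §3 The packaged world `KSMInf` and `KSMInf → ¬ AFToOnsetUKPc` -/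
section World

/-- **K-SM∞ — the kill-world of the super-polynomial regime of `stub_afOnsetUc`** (owner ym-beyond-p2 R83: «strong
mixing at SOME scale for all large `β`, but only at scales `ℓ_SM` with `ℓ_SM / ξ_NT → ∞`»): an admissible SIMPLY
CONNECTED compact simple `G` (the non-simply-connected groups are the wire worlds of
`Negative/OnsetUcFalseOfMonopoleWire`, where the format fails at every mesh and X^{Uc} holds vacuously), a faithful
unitary `r`, a positive NT-calibrated unit map `a` (`LowerBounds G r a`), admissible `(n, ε, δ)`, and a late onset.
A closed `Prop`, NOT asserted and NOT instantiated in the tree; judged empty at physics grade (module docstring). -/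
def KSMInf : Prop :=
  ∃ (G : Type) (_ : Group G) (_ : TopologicalSpace G) (_ : IsTopologicalGroup G) (_ : CompactSpace G),
    IsCompactSimpleLieGroup G ∧ SimplyConnectedSpace G ∧
      (letI : MeasurableSpace G := borel G; haveI : BorelSpace G := ⟨rfl⟩;
        ∃ (r : LatticeRep G) (a : ℝ → ℝ), (∀ β, 0 < a β) ∧ LowerBounds G r a ∧
          ∃ (n : ℕ) (ε δ : ℝ), 1 ≤ n ∧ 0 ≤ ε ∧ ε * OnsetFormats.shellCount n ≤ 3 / 4 ∧ 0 < δ ∧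
            LateOnsetAt r a n ε δ)

/-- **`KSMInf → ¬ AFToOnsetUKPc`**: the registered X^{Uc} is false in the K-SM∞ world. -/
theorem not_afToOnsetUKPc_of_ksmInf (h : KSMInf) : ¬ AFToOnsetUKPc := by
  obtain ⟨G, _, _, _, _, hG, -, r, a, ha, hlb, n, ε, δ, hn, hε, hM, hδ, hlate⟩ := h
  exact not_afToOnsetUKPc_of_lateOnsetAt hG r a ha hlb n ε δ hn hε hM hδ hlate

/-- Contrapositive bookkeeping: `AFToOnsetUKPc` empties the K-SM∞ world. -/
theorem not_ksmInf_of_afToOnsetUKPc (hX : AFToOnsetUKPc) : ¬ KSMInf :=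
  fun h => not_afToOnsetUKPc_of_ksmInf h hX

end World

end Summit.QuantumFields.YangMills.Cruxes.IR.AfPincerUc

end
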